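import Mathlib
import HarnessLib
import HarnessLib.Audit
import Summits.HodgeConjecture.Statement
import Summits.HodgeConjecture.HodgeConjecture.Theorems.Ring2HypothesesCMPivot
import Summits.HodgeConjecture.HodgeConjecture.Theorems.PadicSemiregularLiftHodgeAbelianVarietiesStubCmAnchoredFamilies
import Literature.AlgebraicGeometry.Motives.BaseChange
import HarnessLib.Audit.Status.Attr

/-!
Route: QbarWayStations

# Route QbarWayStations — ℚ̄-points as way-stations — HC_CM transported to ℚ̄-fibres, then
ℚ̄-saturation to all complex abelian varieties

LINE for rung H1 (= `Theses.PadicSemiregularLift.HodgeAbelianVarieties`, HC for complex abelian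
varieties) of LADDER-HodgeAV, with the HELD
hypothesis HC_CM displayed as the binder `CMAbelianHodge` (stmt-HodgeConjecture-3052, residual). It
suffices to show X = X1 ∧ X2 where
X1 = `CMToQbarFibres`: assuming HC_CM, a fibrewise-Hodge global class of a smooth projective family
with a CM fibre is algebraic at every
fibre that is an abelian variety DEFINABLE OVER A NUMBER FIELD (the ℚ̄-fibres are reached from the
CM anchor by ARITHMETIC transport:
reductions mod primes, Tate over finite fields from HC_CM by Milne 1999, algebraization of
formal/potentially-Tate leaves à la Bost–André);
X2 = `QbarToComplexAV`: the Hodge conjecture for abelian varieties definable over number fields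
implies it for all complex abelian varieties
(ℚ̄-SATURATION inside the abelian world: Hodge-generic ℚ̄-points of Mumford–Tate families are
analytically dense (arXiv:2606.08882 Thm 1.3)
and algebraicity of a flat Hodge class does not jump away from a Hodge-generic ℚ̄-fibre — the
higher-codimension Maulik–Poonen/André statement).
The CM-anchored Mumford–Tate families (`CMAnchoredFamilies`, in print: Deligne 1982 Prop. 6.1, tree
node) supply the paths. No summit and no
rung is proved by filing this line; HC_CM stays HELD and displayed.
Lean: `Summit.HodgeConjecture.HodgeConjecture.Theses.QbarWayStations.CMToQbarFibres ∧
Summit.HodgeConjecture.HodgeConjecture.Theses.QbarWayStations.QbarToComplexAV`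

## Assembly
Given A and a rational (p,p) class c: `CMAnchoredFamilies` puts (A,c) in a family with a CM fibre A₀
and a fibrewise-Hodge G with G|_A = c.
`QbarToComplexAV` reduces H1 to abelian varieties with a number-field model; for such an A the same
family is CM-anchored and A is a
ℚ̄-fibre, so `CMToQbarFibres` (fed the displayed `CMAbelianHodge`) makes G|_A = c algebraic; the
Hodge-model conjunct of `HodgeConjectureFor`
is the tree theorem `cmFamilies_nonempty_hodgeModel`. Pure logic over these four binders (deciding
theorem `closes` in glue.lean, 6 lines).

CLOSES_TARGET: closes rung H1 of HodgeConjecture: Summit.HodgeConjecture.HodgeConjecture.Theses.PadicSemiregularLift.HodgeAbelianVarieties (D-0061; not the summit Statement) — the deciding theorem of this route concludes that registered leaf instead of the Statement decl `HodgeConjecture` (class rung: servable and labelled, never counted as concluding the summit Statement).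

Rationale: WHY THIS LINE. Every listed H1 road moves a class from a CM anchor to a general complex fibre in ONE
analytic step (VHC / Bloch semiregularity / p-adic BEK
lifting at one prime / o-minimal normal functions / uniform CM degree), and the ℚ̄→ℂ step in the
tree (PeriodDeficiency `GenericityReduction`,
BoundaryReadout, QbarEnvelope) needs HC over ℚ̄ for the compactified TOTAL SPACE, which is not an
abelian variety. This line inserts the
countable dense set of ℚ̄-POINTS as way-stations and splits the transport into two steps of
different nature: CM → ℚ̄ is ARITHMETIC (a
ℚ̄-abelian variety has reductions at all primes; HC_CM gives the Tate conjecture for abelian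
varieties over finite fields (Milne 1999,
[corpus:paper:doi-10-1215-s0012-7094-99-09620-5 p.30]); reductions of a Hodge class on a ℚ̄-AV are
Tate classes; the lever "reductions at a
density-one set of primes decide algebraicity" is Bost's algebraic-leaves theorem in the Hom case
[corpus:paper:doi-10-1007-s10240-001-8191-3]
and Costa–Sertöz give the effective obstruction to lifting Tate classes
[galaxy:pdf:5937747177045521880]); ℚ̄ → ℂ is a NO-JUMP statement at
Hodge-generic ℚ̄-points (Maulik–Poonen [corpus:paper:arxiv-0907.4781 p.2–4]: proved for divisors =
André 1996 Thm 5.2(3), higher codimension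
conditional on the p-adic VHC; Urbanik-type density of Hodge-generic ℚ̄-points
[corpus:paper:arxiv-2606.08882 p.3–4, §1.1 p.4 "conjecturally
S_Motivic = S(ℚ̄) … weaker results that such a locus is big"]). Imported areas: arithmetic geometry
of abelian varieties over number
fields and finite fields (Tate, Milne, Bost, G-functions) and p-adic Hodge theory (Berthelot–Ogus,
Maulik–Poonen). None of the 40 listed
routes uses ℚ̄-points of the base as the pivot; the negatives index (6 refuted statements:
Fermat/CM-degree/derived/mirror lines) is untouched.

RANKED CRUXES. #2 CMToQbarFibres (crux) — assuming HC_CM (displayed antecedent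
`Theses.RankFourFaces.CMAbelianHodge`): for every smooth projective family f : 𝒳 → S over a smooth
irreducible quasi-projective complex base, every CM abelian-variety fibre A₀ ≅ 𝒳_s₀, every global
class G ∈ H^2p(𝒳) whose restriction to every abelian-variety fibre is rational of type (p,p), and
every fibre A₁ ≅ 𝒳_t that is an abelian variety admitting a model over a number field, the
restriction of G to A₁ is algebraic. [difficulty: open-problem] (why it might fail: beyond
codimension 1 "reductions decide" needs Tate over 𝔽_q for ALL reductions plus a
lifting/algebraization step (Bost is Hom-only; Costa–Sertöz obstructions are non-trivial); a
ℚ̄-fibre far from the CM anchor may admit no prime where both behave.)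
[doi:10.1215/s0012-7094-99-09620-5, doi:10.1007/s10240-001-8191-3, arXiv:2003.11037,
Deligne1982HodgeCycles]
#3 QbarToComplexAV (crux) — if the Hodge conjecture holds for every complex abelian variety whose
underlying variety admits a model over a number field, then it holds for every complex abelian
variety (rung H1). [difficulty: open-problem] (why it might fail: a flat Hodge class algebraic at
all ℚ̄-fibres of a ℚ̄-family could still fail at the geometric generic fibre (countably many proper
jump loci can cover S(ℚ̄)); Maulik–Poonen's no-jump is proved only for divisors, higher codimension
being conditional on p-adic VHC.) [arXiv:0907.4781, arXiv:2606.08882, Andre1996Motifs,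
CharlesSchnell2014Notes]
#4 CMAbelianHodge (crux) — RESIDUAL / HELD hypothesis HC_CM displayed by name (shared item
stmt-HodgeConjecture-3052, verbatim body): the Hodge conjecture for complex abelian varieties of CM
type. Not attacked by this line; declared `residual`. [difficulty: open-problem] (why it might fail:
it is the HC for CM abelian varieties — open from dimension 4 on (André's degenerate CM types, Weil
classes on CM fourfolds); this line only displays it.) [Deligne1982HodgeCycles, Andre1992CM,
MoonenZarhin1999]
#9 CMAnchoredFamilies (support) — every rational (p,p) class on a complex abelian variety A is the
restriction of a fibrewise-Hodge global class of a smooth projective family over a smooth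
irreducible quasi-projective base having A as a fibre and a CM abelian variety as another fibre
(Mumford–Tate families; Deligne 1982 Prop. 6.1; tree node `Ring2.Hypotheses.CMAnchoredFamilies`, in
print). [difficulty: L] [Deligne1982HodgeCycles, Abdulali1994FamiliesAV, CharlesSchnell2014Notes]

TWO-LAYER PLAN. CMToQbarFibres ⇐ (transport to HODGE-GENERIC ℚ̄-fibres:
`stub_cmToGenericQbarFibres`) → (re-anchoring inside the special subvariety through
t, where t is Hodge-generic and CM points are dense: `stub_reanchor`) → CMToQbarFibres; the
arithmetic heart "reductions decide algebraicity
for potentially-Tate flat classes on ℚ̄-abelian varieties" (RED) is filed informally after open (no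
finite-field cycle vocabulary in the tree).
QbarToComplexAV ⇐ (Hodge-generic ℚ̄-anchored Mumford–Tate packaging, in print:
`stub_genericQbarAnchor`) → (no-jump at Hodge-generic
ℚ̄-fibres of abelian families: `stub_noJump`) → QbarToComplexAV. Both skeletons are kernel-checked
in Sketch.lean (sorries = stubs).

KILL CRITERIA. A ℚ̄-abelian variety in a CM-anchored family carrying a flat Hodge class that is
provably NON-algebraic would refute CMToQbarFibres and H1
itself (not expected). The line is killed (close refuted:QbarToComplexAV) by an abelian scheme over
a ℚ̄-curve with a flat Hodge class
algebraic at every ℚ̄-fibre but not at the generic fibre; it is MOOTED if `LocalVHCAtCM` (H1a) or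
`AbelianSchemeVHC` (H1b) closes (then
HC_CM ⇒ H1 directly) and it PIVOTS to "ℚ̄-generic anchors only" if no-jump is refuted at special
ℚ̄-points but survives at Hodge-generic ones.

NOT DECOMPOSED YET. The finite-field side of CMToQbarFibres (Tate classes of reductions, Milne's
HC_CM ⇒ Tate/𝔽_q, the lifting obstruction) is not typed: the
tree has no cycle-class vocabulary over finite fields (LosTransfer filed the same gap); it enters as
an informal rank-4 item after open. The
density input (Hodge-generic ℚ̄-points of special subvarieties are analytically dense) is support
inside `stub_genericQbarAnchor`.

CHEAPEST FALSIFIER. Look for a published abelian scheme over a curve defined over ℚ̄ with a flat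
Hodge class whose algebraicity locus is a countable union of
proper ℚ̄-subvarieties containing infinitely many ℚ̄-points (a "jumping algebraicity without jumping
Hodge-ness" example). Ran: corpus
`lit search --hybrid "algebraicity locus countable union Hodge generic abelian scheme"` and galaxy
"jumping locus|Picard number jumps" —
no such example; Maulik–Poonen Thm 1 / André 5.2(3) show the divisor analogue cannot happen
[corpus:paper:arxiv-0907.4781 p.3].

NUMBERS. Codimension ceiling of every ingredient in print: 1 (NS / End / Hom): André 1996 Thm 5.2(3)
= Maulik–Poonen 2012 Thm 1; Bost 2001 Thm 2.3
(Hom); Tate's theorem for divisors on abelian varieties over finite fields (1966); Masser 1996 (End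
specialization at ℚ̄-points).

DEFINITION REQUESTS. None filed now. Wanted later (shared with LosTransfer): cycle classes / Tate
classes for smooth projective varieties over finite fields and
the specialization map from a number-field model (to type RED).

Novelty: Searches (2026-08-27/28): lit search --hybrid "Hodge generic points algebraic points dense period
image" (6 hits; arXiv:2606.08882 held, read
pp.1–9); lit search "Maulik Poonen Néron-Severi groups under specialization" (5 corpus hits, paper
held as arxiv-0907.4781, read pp.1–4);
lit search --hybrid "Bost algebraic leaves foliations number fields abelian varieties" (held
doi-10-1007-s10240-001-8191-3); lit frontier
HodgeConjecture --since 2023 (run in g2 survey); lit galaxy search "Hodge generic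
points|Hodge-generic points" --star all (2:
[galaxy:panama:394810573717608] Carlson–Müller-Stach–Peters, [galaxy:pdf:-3635845324500155800]);
"jumping locus|Picard number jumps" (13, none
on higher codimension); "Lefschetz classes on abelian varieties|Tate conjecture for abelian
varieties over finite fields" (2:
[galaxy:panama:346861558824997] Kerr–Pearlstein LMS 427, [galaxy:pdf:5937747177045521880]
Costa–Sertöz arXiv:2003.11037); "algebraic
leaves|foliations over number fields" (12: [galaxy:panama:462722596601887] Esnault LNM 2337,
[galaxy:panama:346603860787288] Pila); tree:
`lean search CMAnchoredFamilies` (13 decls; `Ring2HypothesesGeneralFibre` proves the CM-anchored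
GENERAL-FIBRE class target ↔ HC_CM given
(1.1) — this line replaces (1.1) by the two-step ℚ̄ pivot), routes_all.txt (40 routes: none pivots
on ℚ̄-points of the base).
Nearest prior art found: arXiv:0907.4781 (Maulik–Poonen: no-jump ℚ̄-points for NS; §9 higher
codimension under p-adic VHC); arXiv:2606.08882
Thm 1.3–1.5  [refs: 2606.08882, 2003.11037, 0907.4781, arxiv-0907.4781, doi-10-1007-s10240-001-8191-3]

Barriers (technique_class: arithmetic-transport, qbar-points, no-jump, cm-pivot): - technique_class: arithmetic-transport, qbar-points, no-jump, cm-pivot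
- Literature.Barriers.HodgeConjecture.Andre1996_hodgeClassesOnAbelianVarieties_motivated: inside
André's world only as INPUT (Hodge classes on AVs are motivated, so they have well-defined
reductions/ℓ-adic avatars and are absolute Hodge); the barrier "motivated ⇏ algebraic by
Hodge-theoretic means" is evaded because the deciding step of CMToQbarFibres is arithmetic (Tate
classes over finite fields + lifting), a technique class André's theorem does not quantify over;
honest bet: HC_CM ⇒ Tate/𝔽_q (Milne) is the only place HC_CM is consumed.
- Literature.Barriers.HodgeConjecture.CattaniDeligneKaplan1995_hodgeLocus_algebraicFor: outside —
algebraicity of the Hodge LOCUS is never used to produce a cycle; QbarToComplexAV works at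
Hodge-GENERIC points (empty Hodge-locus contribution) and asks for constancy of the ALGEBRAICITY
locus there, which CDK neither gives nor forbids; the bet is the p-adic (Berthelot–Ogus /
Maulik–Poonen) description of that locus.
- Negatives index: the 6 refuted statements of the summit (SparseFermat 18620, MilnorKExponential
17744, So7OddThetaNulls 18788, MirrorBraneLift 18677, DerivedTorelliFermat 11121, ELineTransport
12555) concern Fermat degrees, CM-degree bounds, theta-nulls, mirror/derived lines; no item here
restates one (CMComplexitySaturation-type uniform degree bounds are deliberately NOT claimed). Other
catalogued files placed: AbsoluteHodgeClasses (Deligne) — consistent, us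

sub-problem: HodgeConjecture · status: draft · opened planner-hodge-idea-2-g2-0 2026-08-28T00:21:08Z · rev 0 · ledger route-HodgeConjecture-QbarWayStations
GENERATED by the gate from the ledger (D-0016/17). Provers cite these decls: `theorem foo : Summit.HodgeConjecture.HodgeConjecture.Theses.QbarWayStations.<Decl> := …` in Summits/HodgeConjecture/HodgeConjecture/Theorems/<Name>.lean.
-/

namespace Summit.HodgeConjecture.HodgeConjecture.Theses.QbarWayStations

open scoped BigOperators Topology Manifold Classical MeasureTheory ProbabilityTheory Matrix InnerProductSpace ComplexConjugate ContinuousMap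
open Filter Set Function TopologicalSpace MeasureTheory

attribute [summit_statement] _root_.HodgeConjecture
attribute [summit_statement] _root_.Summit.HodgeConjecture.HodgeConjecture.Theses.PadicSemiregularLift.HodgeAbelianVarieties

/-- item stmt-HodgeConjecture-24069 · crux · rank 3 · open · by planner
why it might fail: a flat Hodge class algebraic at all ℚ̄-fibres of a ℚ̄-family could still fail at the geometric generic fibre (countably many proper jump loci can cover S(ℚ̄)); Maulik–Poonen's no-jump is proved only for divisors, higher codimension being conditional on p-adic VHC.
sources: arXiv:0907.4781, arXiv:2606.08882, Andre1996Motifs, CharlesSchnell2014Notes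
[crux] if the Hodge conjecture holds for every complex abelian variety whose underlying variety
admits a model over a number field, then it holds for every complex abelian variety (rung H1).
[difficulty: open-problem] -/
@[route_item "route-HodgeConjecture-QbarWayStations", crux]
def QbarToComplexAV : Prop :=
  (∀ A : Literature.AlgebraicGeometry.Motives.AbelianVariety ℂ, (∃ (K : Type) (_ : Field K) (_ : NumberField K) (σ : K →+* ℂ) (X₀ : Literature.AlgebraicGeometry.Motives.SchemeOver K), Nonempty (A.X ≅ (Literature.AlgebraicGeometry.Motives.baseChangeHom σ).obj X₀)) → Literature.AlgebraicGeometry.HodgeTheory.HodgeConjectureFor A.dim A.X) → Summit.HodgeConjecture.HodgeConjecture.Theses.PadicSemiregularLift.HodgeAbelianVarieties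

/-- item stmt-HodgeConjecture-3052 · crux · rank 4 · open · by planner
why it might fail: it is the HC for CM abelian varieties — open from dimension 4 on (André's degenerate CM types, Weil classes on CM fourfolds); this line only displays it.
sources: Deligne1982HodgeCycles, Andre1992CM, MoonenZarhin1999
[support] MILESTONE: the Hodge conjecture for complex abelian varieties of CM type (End⁰(A) ⊇ a
commutative reduced ℚ-subalgebra of dimension 2 dim A; smooth-projectivity quantified as a witness
as in the barrier files). Open in general (Pohlmann1968: equivalent to the Tate conjecture for A;
Milne1999: implies Tate for all abelian varieties over finite fields; known for nondegenerate CM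
types, prime dimension, special Weil-type examples — vanGeemen1994HodgeAV §4). In this route it is
LIFT ∧ ENV on the CM family: ENV holds by CM idempotents (Pohlmann1968), LIFT is to come from ALG
via primes of supersingular reduction (Frobenius = complex conjugation in the reflex closure;
positive density, unramified, p > g + 6) where A₁ ~ E^g and H^{2p} is spanned by products of
divisors. Sources: Pohlmann1968, Milne1999, Deligne1982HodgeCycles, vanGeemen1994HodgeAV. -/
@[route_item "route-HodgeConjecture-QbarWayStations", crux]
def CMAbelianHodge : Prop :=
  ∀ (A : Literature.AlgebraicGeometry.Motives.AbelianVariety ℂ), Literature.AlgebraicGeometry.Motives.IsSmoothProjective A.dim A.X → (∃ S : Subalgebra ℚ A.endAlgebra, IsReduced ↥S ∧ (∀ x ∈ S, ∀ y ∈ S, x * y = y * x) ∧ Module.finrank ℚ ↥S = 2 * A.dim) → Literature.AlgebraicGeometry.HodgeTheory.HodgeConjectureFor A.dim A.X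

/-- item stmt-HodgeConjecture-24068 · crux · rank 2 · open · by planner
why it might fail: beyond codimension 1 "reductions decide" needs Tate over 𝔽_q for ALL reductions plus a lifting/algebraization step (Bost is Hom-only; Costa–Sertöz obstructions are non-trivial); a ℚ̄-fibre far from the CM anchor may admit no prime where both behave.
sources: doi:10.1215/s0012-7094-99-09620-5, doi:10.1007/s10240-001-8191-3, arXiv:2003.11037, Deligne1982HodgeCycles
[crux] assuming HC_CM (displayed antecedent `Theses.RankFourFaces.CMAbelianHodge`): for every smooth
projective family f : 𝒳 → S over a smooth irreducible quasi-projective complex base, every CM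
abelian-variety fibre A₀ ≅ 𝒳_s₀, every global class G ∈ H^2p(𝒳) whose restriction to every
abelian-variety fibre is rational of type (p,p), and every fibre A₁ ≅ 𝒳_t that is an abelian variety
admitting a model over a number field, the restriction of G to A₁ is algebraic. [difficulty:
open-problem] -/
@[route_item "route-HodgeConjecture-QbarWayStations", crux]
def CMToQbarFibres : Prop :=
  Summit.HodgeConjecture.HodgeConjecture.Theses.RankFourFaces.CMAbelianHodge → ∀ (S 𝒳 : Literature.AlgebraicGeometry.Motives.SchemeOver ℂ) (f : 𝒳 ⟶ S) (m p : ℕ) (G : Literature.AlgebraicGeometry.HodgeTheory.complexBetti 𝒳 (2 * p)) (s₀ t : Literature.AlgebraicGeometry.Motives.ComplexPoints S) (A₀ A₁ : Literature.AlgebraicGeometry.Motives.AbelianVariety ℂ) (e₀ : A₀.X ⟶ 𝒳) (e₁ : A₁.X ⟶ 𝒳), (∃ (P : Literature.AlgebraicGeometry.Motives.SchemeOver ℂ) (j : 𝒳 ⟶ P), Literature.AlgebraicGeometry.Motives.IsProjectiveOver P ∧ AlgebraicGeometry.IsOpenImmersion j.left) → (∃ (P : Literature.AlgebraicGeometry.Motives.SchemeOver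 ℂ) (j : S ⟶ P), Literature.AlgebraicGeometry.Motives.IsProjectiveOver P ∧ AlgebraicGeometry.IsOpenImmersion j.left) → AlgebraicGeometry.Smooth S.hom → IrreducibleSpace S.left → Literature.AlgebraicGeometry.Motives.IsSmoothProjectiveFamily f m → (∃ i : A₀.X ≅ Literature.AlgebraicGeometry.Motives.fiberOver f s₀, e₀ = CategoryTheory.CategoryStruct.comp i.hom (Literature.AlgebraicGeometry.Motives.fiberι f s₀)) → (∃ (ψ : A₀ ⟶ A₀) (μ : Fin (2 * A₀.dim) → ℂ), Function.Injective μ ∧ ∀ i, Module.End.HasEigenvalue (Literature.AlgebraicGeometry.HodgeTheory.complexBetti.map ψ.hom.hom.hom 1).hom (μ i)) → (∀ (B : Literature.AlgebraicGeometry.Motives.AbelianVariety ℂ) (eB : B.X ⟶ 𝒳) (u : Literature.AlgebraicGeometry.Motives.ComplexPoints S), (∃ i : B.X ≅ Literature.AlgebraicGeometry.Motives.fiberOver f u, eB = CategoryTheory.CategoryStruct.comp i.hom (Literature.AlgebraicGeometry.Motives.fiberι f u)) → Literature.AlgebraicGeometry.HodgeTheory.IsRationalClass (Literature.AlgebraicGeometry.HodgeTheory.complexBetti.map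 eB (2 * p) G) ∧ Literature.AlgebraicGeometry.HodgeTheory.IsOfHodgeType B.dim B.X (2 * p) p p (Literature.AlgebraicGeometry.HodgeTheory.complexBetti.map eB (2 * p) G)) → (∃ i : A₁.X ≅ Literature.AlgebraicGeometry.Motives.fiberOver f t, e₁ = CategoryTheory.CategoryStruct.comp i.hom (Literature.AlgebraicGeometry.Motives.fiberι f t)) → (∃ (K : Type) (_ : Field K) (_ : NumberField K) (σ : K →+* ℂ) (X₀ : Literature.AlgebraicGeometry.Motives.SchemeOver K), Nonempty (A₁.X ≅ (Literature.AlgebraicGeometry.Motives.baseChangeHom σ).obj X₀)) → Literature.AlgebraicGeometry.HodgeTheory.complexBetti.map e₁ (2 * p) G ∈ Literature.AlgebraicGeometry.HodgeTheory.algebraicClasses A₁.X p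

/-- item stmt-HodgeConjecture-24070 · crux (kind.auto-crux: conjecture-grade) · rank 9 · open · by planner
why it might fail: auto-crux — conjecture-grade statement (statement references the registered conjecture Summit.HodgeConjecture.HodgeConjecture.Ring2.Hypotheses.CMAnchoredFamilies); it is open, so it may simply be false
sources: Deligne1982HodgeCycles, Abdulali1994FamiliesAV, CharlesSchnell2014Notes
[support] every rational (p,p) class on a complex abelian variety A is the restriction of a
fibrewise-Hodge global class of a smooth projective family over a smooth irreducible
quasi-projective base having A as a fibre and a CM abelian variety as another fibre (Mumford–Tate
families; Deligne 1982 Prop. 6.1; tree node `Ring2.Hypotheses.CMAnchoredFamilies`, in print).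
[difficulty: L] -/
@[route_item "route-HodgeConjecture-QbarWayStations", crux]
def CMAnchoredFamilies : Prop :=
  Summit.HodgeConjecture.HodgeConjecture.Ring2.Hypotheses.CMAnchoredFamilies

/-- item stmt-HodgeConjecture-24071 · assembly · rank 1 · open · by planner
sources: Deligne1982HodgeCycles
[assembly] CMToQbarFibres → QbarToComplexAV → CMAnchoredFamilies → CMAbelianHodge → rung H1. -/
@[route_item "route-HodgeConjecture-QbarWayStations"]
def Assembly : Prop :=
  CMToQbarFibres → QbarToComplexAV → CMAnchoredFamilies → CMAbelianHodge → Summit.HodgeConjecture.HodgeConjecture.Theses.PadicSemiregularLift.HodgeAbelianVarieties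

/-! D-0027 §2.1 — DECIDING THEOREM (planner-authored via `route open/edit --closes-file`; by planner-hodge-idea-2-g2-0 2026-08-28T00:21:08Z):
its hypotheses are this route's items and its conclusion the registered leaf `Summit.HodgeConjecture.HodgeConjecture.Theses.PadicSemiregularLift.HodgeAbelianVarieties` (rung H1, D-0061) (glue_lint), and it elaborates with this file. -/

@[closes "route-HodgeConjecture-QbarWayStations"] theorem closes (h₁ : Summit.HodgeConjecture.HodgeConjecture.Theses.QbarWayStations.CMToQbarFibres) (h₂ : Summit.HodgeConjecture.HodgeConjecture.Theses.QbarWayStations.QbarToComplexAV)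
    (h₃ : Summit.HodgeConjecture.HodgeConjecture.Theses.QbarWayStations.CMAnchoredFamilies) (h₄ : Summit.HodgeConjecture.HodgeConjecture.Theses.QbarWayStations.CMAbelianHodge) :
    Summit.HodgeConjecture.HodgeConjecture.Theses.PadicSemiregularLift.HodgeAbelianVarieties := by
  have hA : Summit.HodgeConjecture.HodgeConjecture.Theses.QbarWayStations.Assembly := by
    intro g₁ g₂ g₃ g₄
    refine g₂ (fun A hQ => ⟨Summit.HodgeConjecture.HodgeConjecture.Cruxes.HodgeAbelianVarieties.SubtorusGalleryBlochSeeds.Stubs.cmFamilies_nonempty_hodgeModel A, fun p c hrat hhodge => ?_⟩)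
    obtain ⟨S, 𝒳, f, G, t, s₀, e, A₀, e₀, h𝒳, hS, hsm, hirr, hfam, hincl, hincl₀, hcm, hG, hAlong⟩ :=
      g₃ A p c hrat hhodge
    have key := g₁ g₄ S 𝒳 f A.dim p G s₀ t A₀ A e₀ e h𝒳 hS hsm hirr hfam hincl₀ hcm hAlong hincl hQ
    rw [hG] at key
    exact key
  exact hA h₁ h₂ h₃ h₄

end Summit.HodgeConjecture.HodgeConjecture.Theses.QbarWayStations
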